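import Mathlib
import HarnessLib
import Summits.Parity.Statement
import Summits.Parity.GeneralizedHardyLittlewood.Theses.SiegelSpectrumSplit
import Summits.Parity.GeneralizedHardyLittlewood.Theorems.ShiftedPrimeFactorNecessity
import Summits.Parity.GeneralizedHardyLittlewood.Theorems.FixedLowerQualitativeCore
import Literature.Barriers.Parity.PrimePairParity
import Literature.NumberTheory.Sieve.ParityWave0
import Literature.NumberTheory.Sieve.ParityWave0TwinPrimeProofs
import Summits.Parity.GeneralizedHardyLittlewood.Theorems.FixedLowerParityBitDefs

/-!
# `FixedLower` — the parity bit at shifted primes and the floor of the prime-pair parity barrier (helper for stmt-Parity-26863)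

Decomp-parity lens-4 g8 consequence notch «ParityBitFloor» beneath the record leaf
`FL = SiegelSpectrumSplit.FixedLower` (stmt-Parity-26863), ported from the lens kernel
`HOME/decomp-parity-lens-4/g8/ParityBitFloor.lean` (rc 0 · 0 sorry · standard axioms) with the two
`Prop`s INLINED (D-0026: no `def : Prop` here): `OddShift` ≡ `oddShiftSet.Infinite`,
`OddShiftLift` ≡ `oddShiftSet.Infinite → FixedLower`; the three data sets `oddShiftSet` / `evenShiftSet` /
`sameSignSet` are `Theorems/FixedLowerParityBitDefs.lean` (critic CLEARED HOME/STATUS.md l.509, CRITIC-LEDGER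
row 92; writer ruling l.508).

For a prime `p` the pair `(p, p+2)` is parity-correct iff `λ(p+2) = λ(p) = -1`, i.e. iff `Ω(p+2)` is odd.
The PRIME BUDGET `j` of a statement on the twin face = the number of coordinates required to be prime,
the others only parity-correct: `j = 2` `twinSet` infinite (twin primes, open); `j = 1` `oddShiftSet`
infinite, i.e. `λ(p+2) = -1` for infinitely many primes `p` — OPEN IN PRINT (Pintz, Indag. Math. 26 (2015)
= arXiv:1004.1065, p. 2: «it is not known whether there are infinitely many primes p such that p + 2 has an
odd number of prime factors»; p. 3: not even under Elliott–Halberstam for a single given shift; printed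
rungs: some even `0 < |d| ≤ 16` unconditionally, Thm 1; `|d| ≤ 2` at level `ϑ > 0.729`, Thm 7);
`j = 0` `sameSignSet = {n ≥ 1 : λ(n) = λ(n+2)}` infinite — a THEOREM (`sameSignSet_infinite`, §6).

* §1 dictionary: `twinSet ⊆ oddShiftSet ⊆ sameSignSet`; the primes are the disjoint union of
  `oddShiftSet` and `evenShiftSet`.
* §2 NECESSITY (hypothesis-free, through the landed `ShiftedPrimeFactor.twinPrimeConjecture_of_fixedLower`
  / `.fixedLower_of_ghl`): `FL ⟹ oddShiftSet.Infinite`, also from the conjunct and the root.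
* §3 EXACTNESS `fixedLower_iff : FL ↔ oddShiftSet.Infinite ∧ (oddShiftSet.Infinite → FL)`; T21 normal form
  of the residual via the landed `QualitativeCore.lift_iff`; separating world `¬ oddShiftSet.Infinite`.
* §4 THE PARITY BIT: `oddShift_or_evenShift` (pigeonhole); `evenShift_or_twin` from Chen's theorem in the
  tree's form `chen_twin` (PROVED in the tree as `chen_twin_holds`, module `ParityWave0Holds` — taken by NAME
  as a hypothesis to keep this file's import closure inside built modules); the typed minimal-counterexample
  world `world_of_not_oddShift`.
* §5 BARRIER FLOOR: `barred_of_weight_vanishes` — any set on which the twin parity weight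
  `ω(n) = 1 − λ(n)λ(n+2)` of `Literature.Barriers.Parity.PrimePairParity` vanishes is barred from every
  sieve-theoretic deduction (`IsSieveTheoreticDeduction`); `ω = 0` exactly on `sameSignSet`; instances
  `sameSignSet_barred`, `oddShiftSet_barred` (the twin instance is `PrimePairParity_holds`, by name).
* §6 `sameSignSet_infinite` (complete multiplicativity: `λ(8m) = −λ(4m)` defeats eventual `4`-periodicity)
  and `floor_witness`: the barred budget-0 set is provably infinite — the catalogued barrier is a statement
  about a METHOD CLASS, not about truth; `oddShiftSet.Infinite` is the weakest OPEN rung of the axis.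

Helper file `--supports stmt-Parity-26863` (it closes no item; zero distance credit).  0 sorry · standard
axioms only · THEOREMS ONLY (no `def`).
-/

open ArithmeticFunction
open Literature.Barriers.Parity
open Literature.NumberTheory.Sieve (TwinPrimeConjecture DicksonConjecture chen_twin
  twinPrimeConjecture_of_dicksonConjecture twinPrimeConjecture_iff_setOf_infinite)

namespace Summit.Parity.GeneralizedHardyLittlewood.ParityBit

open Summit.Parity.GeneralizedHardyLittlewood.Theses.SiegelSpectrumSplit (FixedLower)
open Summit.Parity.GeneralizedHardyLittlewood.QualitativeCore (QuantLift)

/-! ## §1 Dictionary on the prime-budget sets (`FixedLowerParityBitDefs`) -/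

/-- `λ(n) ∈ {1, -1}` for `n ≠ 0`. -/
private theorem liouville_eq_or {n : ℕ} (hn : n ≠ 0) : liouville n = 1 ∨ liouville n = -1 := by
  rw [liouville_apply hn]; exact neg_one_pow_eq_or ℤ _

/-- The twin set of the barrier file sits inside the budget-1 set: `p + 2` prime ⇒ `Ω(p+2) = 1`. -/
theorem twinSet_subset_oddShiftSet : twinSet ⊆ oddShiftSet := fun n hn =>
  ⟨hn.1, by rw [cardFactors_apply_prime hn.2]; exact odd_one⟩

/-- Budget 1 sits inside budget 0: for `p` prime with `Ω(p+2)` odd, `λ(p) = λ(p+2) = -1`. -/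
theorem oddShiftSet_subset_sameSignSet : oddShiftSet ⊆ sameSignSet := by
  rintro p ⟨hp, hodd⟩
  refine ⟨hp.pos, ?_⟩
  rw [liouville_apply hp.ne_zero, cardFactors_apply_prime hp, liouville_apply (by omega), hodd.neg_one_pow]
  norm_num

/-- `twinSet ⊆ sameSignSet`. -/
theorem twinSet_subset_sameSignSet : twinSet ⊆ sameSignSet :=
  twinSet_subset_oddShiftSet.trans oddShiftSet_subset_sameSignSet

/-- Every prime is in exactly one of the two parity classes. -/
theorem setOf_prime_eq_union : {p : ℕ | p.Prime} = oddShiftSet ∪ evenShiftSet := by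
  ext p
  simp only [Set.mem_setOf_eq, Set.mem_union, oddShiftSet, evenShiftSet]
  constructor
  · intro hp
    rcases Nat.even_or_odd (cardFactors (p + 2)) with h | h
    · exact Or.inr ⟨hp, h⟩
    · exact Or.inl ⟨hp, h⟩
  · rintro (⟨hp, -⟩ | ⟨hp, -⟩) <;> exact hp

/-- The two parity classes are disjoint. -/
theorem oddShiftSet_disjoint_evenShiftSet : Disjoint oddShiftSet evenShiftSet := by
  rw [Set.disjoint_left]
  rintro p ⟨-, ho⟩ ⟨-, he⟩
  exact (Nat.not_even_iff_odd.mpr ho) he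

/-! ## §2 Necessity of the credited piece (hypothesis-free, through landed theorems) -/

/-- `j = 2 ⟹ j = 1`: the twin prime conjecture implies `oddShiftSet` infinite. -/
theorem oddShift_of_twinPrimeConjecture (h : TwinPrimeConjecture) : oddShiftSet.Infinite :=
  ((twinPrimeConjecture_iff_setOf_infinite.mp h : twinSet.Infinite)).mono twinSet_subset_oddShiftSet

/-- Dickson's conjecture implies `oddShiftSet` infinite (tree: `twinPrimeConjecture_of_dicksonConjecture`). -/
theorem oddShift_of_dicksonConjecture (h : DicksonConjecture) : oddShiftSet.Infinite :=
  oddShift_of_twinPrimeConjecture (twinPrimeConjecture_of_dicksonConjecture h)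

/-- **Necessity from the leaf** (edge stmt-Parity-26863 ⟹ «λ(p+2) = -1 i.o.»), through the landed
`ShiftedPrimeFactor.twinPrimeConjecture_of_fixedLower`. -/
theorem oddShift_of_fixedLower (h : FixedLower) : oddShiftSet.Infinite :=
  oddShift_of_twinPrimeConjecture (Theses.ShiftedPrimeFactor.twinPrimeConjecture_of_fixedLower h)

/-- Necessity from the conjunct (landed `ShiftedPrimeFactor.fixedLower_of_ghl`). -/
theorem oddShift_of_ghl (h : _root_.GeneralizedHardyLittlewood) : oddShiftSet.Infinite :=
  oddShift_of_fixedLower (Theses.ShiftedPrimeFactor.fixedLower_of_ghl h)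

/-- Necessity from the root. -/
theorem oddShift_of_parity (h : _root_.Parity) : oddShiftSet.Infinite := oddShift_of_ghl h.2

/-- Against the conjunct both pieces of the notch are necessary. -/
theorem pieces_of_ghl (h : _root_.GeneralizedHardyLittlewood) :
    oddShiftSet.Infinite ∧ (oddShiftSet.Infinite → FixedLower) :=
  ⟨oddShift_of_ghl h, fun _ => Theses.ShiftedPrimeFactor.fixedLower_of_ghl h⟩

/-! ## §3 Exactness and the T21 normal form -/

/-- **The notch is exact at the leaf**: `FL ⟺ oddShiftSet.Infinite ∧ (oddShiftSet.Infinite → FL)`. -/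
theorem fixedLower_iff :
    FixedLower ↔ oddShiftSet.Infinite ∧ (oddShiftSet.Infinite → FixedLower) :=
  ⟨fun h => ⟨oddShift_of_fixedLower h, fun _ => h⟩, fun h => h.2 h.1⟩

/-- T21 NORMAL FORM of the residual (landed `QualitativeCore.lift_iff`):
`(oddShiftSet.Infinite → FL) ⟺ QuantLift ∧ (oddShiftSet.Infinite → Dickson)`. -/
theorem oddShiftLift_iff_floor :
    (oddShiftSet.Infinite → FixedLower) ↔ QuantLift ∧ (oddShiftSet.Infinite → DicksonConjecture) :=
  QualitativeCore.lift_iff oddShift_of_dicksonConjecture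

/-- Three-piece normal form `FL ⟺ oddShiftSet.Infinite ∧ (oddShiftSet.Infinite → Dickson) ∧ QuantLift`
(landed `QualitativeCore.notch_normal_form`). -/
theorem fixedLower_iff_three :
    FixedLower ↔ oddShiftSet.Infinite ∧ (oddShiftSet.Infinite → DicksonConjecture) ∧ QuantLift :=
  QualitativeCore.notch_normal_form oddShift_of_dicksonConjecture

/-- Separating world: if the parity bit fails, the residual holds vacuously … -/
theorem oddShiftLift_of_not_oddShift (h : ¬ oddShiftSet.Infinite) : oddShiftSet.Infinite → FixedLower :=
  fun ho => (h ho).elim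

/-- … and the leaf fails. -/
theorem not_fixedLower_of_not_oddShift (h : ¬ oddShiftSet.Infinite) : ¬ FixedLower :=
  fun hFL => h (oddShift_of_fixedLower hFL)

/-- Given the credited piece, the residual IS the leaf (contraction). -/
theorem contracts (ho : oddShiftSet.Infinite) : (oddShiftSet.Infinite → FixedLower) ↔ FixedLower :=
  ⟨fun hl => hl ho, fun h _ => h⟩

/-! ## §4 The parity bit: pigeonhole, and the side Chen's theorem decides -/

/-- Pigeonhole: one of the two parity classes of shifted primes is infinite. -/
theorem oddShift_or_evenShift : oddShiftSet.Infinite ∨ evenShiftSet.Infinite := by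
  have h : ({p : ℕ | p.Prime}).Infinite := Nat.infinite_setOf_prime
  rw [setOf_prime_eq_union] at h
  exact Set.infinite_union.mp h

/-- Chen's set `{p prime : Ω(p+2) ≤ 2}` splits into twins and `E₂`-shifted primes. -/
theorem chenSet_subset :
    {p : ℕ | p.Prime ∧ Nat.IsAtMostAlmostPrime 2 (p + 2)} ⊆ twinSet ∪ evenShiftSet := by
  rintro p ⟨hp, hne, hle⟩
  have h0 : cardFactors (p + 2) ≠ 0 := by
    rw [Ne, cardFactors_eq_zero_iff_eq_zero_or_one]; omega
  have hcases : cardFactors (p + 2) = 1 ∨ cardFactors (p + 2) = 2 := by omega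
  rcases hcases with h | h
  · exact Or.inl ⟨hp, cardFactors_eq_one_iff_prime.mp h⟩
  · exact Or.inr ⟨hp, by rw [h]; exact even_two⟩

/-- **`evenShiftSet.Infinite ∨ TwinPrimeConjecture` from Chen's theorem** in the tree's form `chen_twin`
(Chen 1973, Thm II; PROVED in the tree as `Literature.NumberTheory.Sieve.chen_twin_holds`). -/
theorem evenShift_or_twin (hChen : chen_twin) : evenShiftSet.Infinite ∨ TwinPrimeConjecture := by
  have hC : ({p : ℕ | p.Prime ∧ Nat.IsAtMostAlmostPrime 2 (p + 2)}).Infinite := hChen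
  rcases Set.infinite_union.mp (hC.mono chenSet_subset) with ht | he
  · exact Or.inr (twinPrimeConjecture_iff_setOf_infinite.mpr ht)
  · exact Or.inl he

/-- Given Chen: if the EVEN class is finite, the twin prime conjecture — hence the credited piece — holds;
the only undecided bit on this axis is `oddShiftSet.Infinite` itself. -/
theorem oddShift_of_not_evenShift (hChen : chen_twin) (h : ¬ evenShiftSet.Infinite) :
    oddShiftSet.Infinite :=
  oddShift_of_twinPrimeConjecture ((evenShift_or_twin hChen).resolve_left h)

/-- **The minimal-counterexample world is typed** (hypothesis-free): if the parity bit fails then the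
even class is infinite, there are finitely many twin primes, and the leaf, the conjunct and the root fail. -/
theorem world_of_not_oddShift (h : ¬ oddShiftSet.Infinite) :
    evenShiftSet.Infinite ∧ ¬ TwinPrimeConjecture ∧ ¬ FixedLower ∧
      ¬ _root_.GeneralizedHardyLittlewood ∧ ¬ _root_.Parity :=
  ⟨oddShift_or_evenShift.resolve_left h, fun ht => h (oddShift_of_twinPrimeConjecture ht),
    not_fixedLower_of_not_oddShift h, fun hg => h (oddShift_of_ghl hg),
    fun hp => h (oddShift_of_parity hp)⟩

/-! ## §5 The barrier floor: every set on which the twin parity weight vanishes is barred -/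

/-- **Barrier schema (the general form behind `PrimePairParity_holds`).**  If the twin parity weight
`ω(n) = 1 − λ(n)λ(n+2)` vanishes on `A`, then relative to any input class containing `ω` NO
sieve-theoretic deduction produces elements of `A`. -/
theorem barred_of_weight_vanishes {A : Set ℕ} (hA : ∀ n ∈ A, twinParityWeight n = 0)
    (Inputs : (ℕ → ℝ) → Prop) (hIn : Inputs twinParityWeight) :
    ¬ IsSieveTheoreticDeduction Inputs A := by
  intro hded
  obtain ⟨x, ν, -, hpos⟩ := hded twinParityWeight twinParityWeight_nonneg hIn
  have hzero : weightedDetectionSum ν A twinParityWeight x = 0 := by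
    unfold weightedDetectionSum
    refine Finset.sum_eq_zero fun n _ => ?_
    by_cases hn : n ∈ A
    · rw [hA n hn, mul_zero]
    · rw [Set.indicator_of_notMem hn, mul_zero, zero_mul]
  rw [hzero] at hpos
  exact lt_irrefl 0 hpos

/-- The weight vanishes on `sameSignSet`. -/
theorem twinParityWeight_eq_zero_of_mem_sameSignSet {n : ℕ} (hn : n ∈ sameSignSet) :
    twinParityWeight n = 0 := by
  obtain ⟨hpos, heq⟩ := hn
  unfold twinParityWeight liouvilleR
  rw [← heq]
  rcases liouville_eq_or (n := n) (by omega) with h | h <;> rw [h] <;> norm_num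

/-- The weight vanishes EXACTLY on `sameSignSet` (`n ≥ 1`). -/
theorem twinParityWeight_eq_zero_iff {n : ℕ} (hn : 0 < n) :
    twinParityWeight n = 0 ↔ n ∈ sameSignSet := by
  refine ⟨fun h => ⟨hn, ?_⟩, twinParityWeight_eq_zero_of_mem_sameSignSet⟩
  unfold twinParityWeight liouvilleR at h
  rcases liouville_eq_or (n := n) (by omega) with h1 | h1 <;>
    rcases liouville_eq_or (n := n + 2) (by omega) with h2 | h2 <;>
    rw [h1, h2] at h ⊢ <;> norm_num at h

/-- Budget 0 is barred. -/
theorem sameSignSet_barred (Inputs : (ℕ → ℝ) → Prop) (hIn : Inputs twinParityWeight) :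
    ¬ IsSieveTheoreticDeduction Inputs sameSignSet :=
  barred_of_weight_vanishes (fun _ hn => twinParityWeight_eq_zero_of_mem_sameSignSet hn) Inputs hIn

/-- Budget 1 (the set of the credited piece) is barred. -/
theorem oddShiftSet_barred (Inputs : (ℕ → ℝ) → Prop) (hIn : Inputs twinParityWeight) :
    ¬ IsSieveTheoreticDeduction Inputs oddShiftSet :=
  barred_of_weight_vanishes
    (fun _ hn => twinParityWeight_eq_zero_of_mem_sameSignSet (oddShiftSet_subset_sameSignSet hn)) Inputs hIn

/-- Any subset of the budget-0 set is barred (budget 2 = `twinSet` is `PrimePairParity_holds`, by name). -/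
theorem barred_of_subset_sameSignSet {A : Set ℕ} (hA : A ⊆ sameSignSet)
    (Inputs : (ℕ → ℝ) → Prop) (hIn : Inputs twinParityWeight) :
    ¬ IsSieveTheoreticDeduction Inputs A :=
  barred_of_weight_vanishes (fun _ hn => twinParityWeight_eq_zero_of_mem_sameSignSet (hA hn)) Inputs hIn

/-! ## §6 The budget-0 rung is a THEOREM: `{n : λ(n) = λ(n+2)}` is infinite -/

/-- If `λ(n+2) = −λ(n)` for all `n ≥ N₀` (`n ≥ 1`), then `λ` is `4`-periodic from `N₀` on. -/
private theorem liouville_add_four_mul {N₀ : ℕ}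
    (hflip : ∀ n, N₀ ≤ n → 0 < n → liouville (n + 2) = -liouville n) :
    ∀ n k : ℕ, N₀ ≤ n → 0 < n → liouville (n + 4 * k) = liouville n := by
  intro n k hn hpos
  induction k with
  | zero => simp
  | succ k ih =>
    have h1 := hflip (n + 4 * k) (by omega) (by omega)
    have h2 := hflip (n + 4 * k + 2) (by omega) (by omega)
    rw [show n + 4 * (k + 1) = n + 4 * k + 2 + 2 by ring, h2, h1, neg_neg, ih]

/-- **`sameSignSet` is infinite.**  Otherwise `λ(n+2) = −λ(n)` eventually, so `λ` is eventually
`4`-periodic; but `λ(8m) = λ(2)λ(4m) = −λ(4m)` while `8m = 4m + 4·m`. -/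
theorem sameSignSet_infinite : sameSignSet.Infinite := by
  by_contra hfin
  rw [Set.not_infinite] at hfin
  obtain ⟨M, hM⟩ := hfin.bddAbove
  have hout : ∀ n, M + 1 ≤ n → n ∉ sameSignSet := fun n hn hmem => by
    have := hM hmem; omega
  have hflip : ∀ n, M + 1 ≤ n → 0 < n → liouville (n + 2) = -liouville n := by
    intro n hn hpos
    have hne : liouville n ≠ liouville (n + 2) := fun h => hout n hn ⟨hpos, h⟩
    rcases liouville_eq_or (n := n) (by omega) with h1 | h1 <;>
      rcases liouville_eq_or (n := n + 2) (by omega) with h2 | h2 <;> omega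
  set m : ℕ := M + 1 with hm
  have hper := liouville_add_four_mul hflip (4 * m) m (by omega) (by omega)
  have h2 : liouville 2 = -1 := by
    rw [liouville_apply two_ne_zero, cardFactors_apply_prime Nat.prime_two]; norm_num
  rw [show 4 * m + 4 * m = 2 * (4 * m) by ring, liouville_apply_mul, h2] at hper
  have hnz : liouville (4 * m) ≠ 0 := liouville_ne_zero (by omega)
  exact hnz (by linarith)

/-- **Barrier non-sharpness witness.**  The budget-0 set is barred from every sieve-theoretic deduction
containing the twin parity weight, yet it is infinite: the catalogued barrier is a statement about a
METHOD CLASS, not about truth. -/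
theorem floor_witness :
    sameSignSet.Infinite ∧
      ∀ Inputs : (ℕ → ℝ) → Prop, Inputs twinParityWeight →
        ¬ IsSieveTheoreticDeduction Inputs sameSignSet :=
  ⟨sameSignSet_infinite, sameSignSet_barred⟩

/-- The prime-budget chain with statuses: `twinSet ⊆ oddShiftSet ⊆ sameSignSet`, the last infinite;
`twinSet` infinite ⟹ `oddShiftSet` infinite ⟹ `sameSignSet` infinite. -/
theorem budget_chain :
    twinSet ⊆ oddShiftSet ∧ oddShiftSet ⊆ sameSignSet ∧ sameSignSet.Infinite ∧
      (twinSet.Infinite → oddShiftSet.Infinite) ∧ (oddShiftSet.Infinite → sameSignSet.Infinite) :=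
  ⟨twinSet_subset_oddShiftSet, oddShiftSet_subset_sameSignSet, sameSignSet_infinite,
    fun h => h.mono twinSet_subset_oddShiftSet, fun h => h.mono oddShiftSet_subset_sameSignSet⟩

end Summit.Parity.GeneralizedHardyLittlewood.ParityBit
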